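/-
Copyright (c) 2026 the pub-hodgecm2 formalisation cell (harness21).  New file, not vendored.
Origin: (c-S.1) RE-KEY error wave, pair «subcorner» seat «b» (prover-pub-hodgecm2-rekey-l1-subcorner-b-g0-0), 2026-08-23.
HELPER for the primed junction (`Rekey/Binders/JLiuSubCornerAdm`, `Rekey/HThetaJunctionR2BGal` §1, `Rekey/HsmallOfBlockAt*`): how PerL's type
recipe `κ` ∕ the (J4a) type `liftType h K L j ι₁ Ψ` behave under (i) conjugating the presentation embedding `ι₁ ↦ ῑ₁ := conj ∘ ι₁` — NOT AT ALL
(the recipe sees only the place: `liftType_starRingEnd_comp`), and (ii) conjugating the guard embedding `j ↦ c_L ∘ j` (the embedding that meets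
the primed guard `ῑ₁ ∘ j' = c.σ` when `ι₁ ∘ j = c.σ`) — by TYPE CONJUGATION (`liftType_conjRingHomK_comp`).  Consequences recorded in the
docstrings: the primed `PhiMu′` guard at a (J4a) line served over `ι₁` is the NEGATION of `GoodCtx.mem`; the primed (J4a) at such a line names
the conjugate type (mirror line `−a_i`).  (S2) the JOINT flip `(h, j, ι₁) ↦ (¬h, c_L ∘ j, ῑ₁)` of the primed supply guard
`SignRecipe.GoodCtx (orientBitι L ῑ₁) ῑ₁ c`: `κ` and the recipe type are INVARIANT, the frame sign and `reqPos` FLIP, the forced signs are the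
OPPOSITE ones (`signsForced_jointFlip_iff`), so at one context the two guards exclude each other (`GoodCtx.not_jointFlip`).
KERNEL ONLY: 17 theorems, 0 defs, nothing cited; imports `Binders/JLiuSignType` only.
HELD pending orientation re-key; HC_CM is NOT proved; NOT «Δ2 BRIDGE CLOSED».
-/
import Summits.HodgeConjecture.HodgeCM.Model.Binders.JLiuSignType

set_option autoImplicit false

/-!
Re-key (c-S.1) seam lemmas for PerL's type recipe — HELD; HC_CM is NOT proved.

# `SignRecipe.kappa` ∕ `liftType` under complex conjugation of the presentation and guard embeddings

(Module docstring added by the pair's filer, seat «a», for the gate's `lint.import`; content = seat «b»'s header above, unchanged bytes below.)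

* §(S1) `kappa_starRingEnd_comp`, `liftType_starRingEnd_comp` — the recipe does not see `ι₁ ↦ ῑ₁ := (starRingEnd ℂ).comp ι₁` (it reads the
  place only); `starRingEnd_comp_mem_liftType_false_iff` — the primed `PhiMu′` guard at a (J4a) line served over `ι₁` is `ι₁ ∘ j ∉ Ψ`;
  `liftType_bar` — the recipe commutes with type conjugation.
* §(S1′) `kappa_conjRingHomK_comp`, `starRingEnd_comp_comp_conjRingHomK_comp`, `liftType_conjRingHomK_comp` — conjugating the guard embedding
  `j ↦ c_L ∘ j` (the embedding meeting the primed guard) conjugates the (J4a) type.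
* §(S2) `kappa_jointFlip`, `liftType_jointFlip`, `isRep_starRingEnd_comp_iff`, `frameSign_starRingEnd_comp`, `reqPos_jointFlip`,
  `signsForced_jointFlip_iff`, `not_signsForced_jointFlip`, `GoodCtx.not_jointFlip` — under the JOINT flip `(h, j, ι₁) ↦ (¬h, c_L ∘ j, ῑ₁)` the
  recipe type is invariant, the frame sign and `reqPos` flip, the forced signs are the opposite ones; hence at one seesaw context the guard of
  record `GoodCtx h ι₁ c` and the primed guard `GoodCtx (!h) ῑ₁ c` EXCLUDE each other.

KERNEL ONLY: theorems, no definition, nothing cited anew; `#print axioms` ⊆ {propext, Classical.choice, Quot.sound}.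
-/

noncomputable section

open NumberField NumberField.ComplexEmbedding
open scoped ComplexConjugate
open Literature.AlgebraicGeometry.Motives (CMType)
open Literature.AlgebraicGeometry.ShimuraVarieties (conjRingHomK embedding_conjRingHomK)

namespace HodgeCM

namespace SignRecipe

variable {K L : CMField}

/-- The `ι₁`-orbit and the `ῑ₁`-orbit of `Aut(L)` in `Hom(L, ℂ)` coincide: `ῑ₁ ∘ (g·c) = ι₁ ∘ g`. [folklore] -/
theorem starRingEnd_comp_comp_trans_conjEquiv (ι₁ : L →+* ℂ) (g : L ≃+* L) :
    ((starRingEnd ℂ).comp ι₁).comp (g.trans (conjEquiv L)).toRingHom = ι₁.comp g.toRingHom := by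
  ext x
  simp only [RingHom.coe_comp, Function.comp_apply, RingEquiv.toRingHom_eq_coe, RingHom.coe_coe,
    RingEquiv.coe_trans, conjEquiv_apply]
  rw [embedding_conjRingHomK, starRingEnd_self_apply]

/-- **(S1) `κ` at the conjugate presentation embedding is `κ`**: the recipe reads the element `g⁻¹ φ^h |_K` of the automorphism orbit, and
conjugating `ι₁` multiplies `g` by the CENTRAL involution `c`. [folklore] -/
theorem kappa_starRingEnd_comp (h : Bool) (j : K →+* L) (ι₁ τ : L →+* ℂ) :
    kappa h K L j ((starRingEnd ℂ).comp ι₁) τ = kappa h K L j ι₁ τ := by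
  by_cases H : ∃ g : L ≃+* L, ι₁.comp g.toRingHom = τ
  · obtain ⟨g, hg⟩ := H
    have hg' : ((starRingEnd ℂ).comp ι₁).comp (g.trans (conjEquiv L)).toRingHom = τ := by
      rw [starRingEnd_comp_comp_trans_conjEquiv, hg]
    ext x
    rw [kappa_of_gal_apply h j _ hg', kappa_of_gal_apply h j g hg, RingEquiv.symm_trans_apply,
      conjEquiv_symm_apply, ringEquiv_map_conj, RingHom.comp_apply, embedding_conjRingHomK, starRingEnd_self_apply]
  · have H' : ¬∃ g : L ≃+* L, ((starRingEnd ℂ).comp ι₁).comp g.toRingHom = τ := by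
      rintro ⟨g, hg⟩
      refine H ⟨g.trans (conjEquiv L), ?_⟩
      rw [← hg, ← starRingEnd_comp_comp_trans_conjEquiv ι₁ (g.trans (conjEquiv L))]
      ext x
      simp only [RingHom.coe_comp, Function.comp_apply, RingEquiv.toRingHom_eq_coe, RingHom.coe_coe,
        RingEquiv.coe_trans, conjEquiv_apply, conjRingHomK_apply, IsCMField.complexConj_apply_apply]
    rw [kappa_of_not_gal h j H', kappa_of_not_gal h j H]

/-- **(S1) on the type**: the (J4a) recipe type at the conjugate presentation embedding is the SAME CM type of `L`. [folklore] -/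
theorem liftType_starRingEnd_comp (h : Bool) (j : K →+* L) (ι₁ : L →+* ℂ) (Ψ : CMType K) :
    liftType h K L j ((starRingEnd ℂ).comp ι₁) Ψ = liftType h K L j ι₁ Ψ :=
  Subtype.ext (Set.ext fun τ => by
    show kappa h K L j ((starRingEnd ℂ).comp ι₁) τ ∈ Ψ.1 ↔ kappa h K L j ι₁ τ ∈ Ψ.1
    rw [kappa_starRingEnd_comp])

/-- Corollary (the distinguished-embedding clause at `ῑ₁`): `ῑ₁ ∈ Φ_Ψ^{(false)} ↔ ι₁ ∘ j ∉ Ψ` — the primed `PhiMu′` guard at a (J4a) line is the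
NEGATION of today's `GoodCtx.mem` (`c.σ = ι₁ ∘ j ∈ Ψᵢ`). [folklore] -/
theorem starRingEnd_comp_mem_liftType_false_iff (j : K →+* L) (ι₁ : L →+* ℂ) (Ψ : CMType K) :
    (starRingEnd ℂ).comp ι₁ ∈ (liftType false K L j ι₁ Ψ).1 ↔ ι₁.comp j ∉ Ψ.1 := by
  rw [← liftType_starRingEnd_comp false j ι₁ Ψ, self_mem_liftType_false_iff]
  exact HodgeCM.CMTypeOps.conjugate_mem_iff_notMem Ψ (ι₁.comp j)

/-- The recipe commutes with type conjugation: `Φ^{(h)}_{Ψ̄} = \overline{Φ^{(h)}_Ψ}` (both memberships are `κ(τ) ∉ Ψ`; no orbit hypothesis). So the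
K1 reading of adm′ (`IsReflexOfTypeG ῑ₁ Φ ↔ IsReflexOfTypeG ι₁ Φ̄`, ✔ p371989) at a (J4a) line is (J4a) for the CONJUGATE corner type `Ψ̄ᵢ` at the
SAME guard `ι₁ ∘ j = c.σ`. [folklore] -/
theorem liftType_bar (h : Bool) (j : K →+* L) (ι₁ : L →+* ℂ) (Ψ : CMType K) :
    liftType h K L j ι₁ (HodgeCM.CMTypeOps.bar Ψ) = HodgeCM.CMTypeOps.bar (liftType h K L j ι₁ Ψ) :=
  Subtype.ext (Set.ext fun _ => Iff.rfl)

/-- **(S1′) `κ` along the CONJUGATED guard `j' := c_L ∘ j`** (the embedding that meets the primed guard: `ῑ₁ ∘ (c_L ∘ j) = ι₁ ∘ j`):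
`κ^{(h)}_{c_L ∘ j}(τ) = \overline{κ^{(h)}_j(τ)}` (centrality of `c_L`, `φ^h ∈ {1, c_L}` commutes with `c_L`). [folklore] -/
theorem kappa_conjRingHomK_comp (h : Bool) (j : K →+* L) (ι₁ τ : L →+* ℂ) :
    kappa h K L ((conjRingHomK L).comp j) ι₁ τ = conjugate (kappa h K L j ι₁ τ) := by
  by_cases H : ∃ g : L ≃+* L, ι₁.comp g.toRingHom = τ
  · obtain ⟨g, hg⟩ := H
    ext x
    rw [kappa_of_gal_apply h _ g hg, conjugate_coe_eq, kappa_of_gal_apply h j g hg, RingHom.comp_apply]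
    cases h
    · rw [phiH_false, RingHom.id_apply, RingHom.id_apply, ringEquiv_map_conj, embedding_conjRingHomK]
    · rw [phiH_true, ringEquiv_map_conj, embedding_conjRingHomK]
  · rw [kappa_of_not_gal h _ H, kappa_of_not_gal h j H]
    ext x
    rw [conjugate_coe_eq, RingHom.comp_apply, RingHom.comp_apply, RingHom.comp_apply, embedding_conjRingHomK]

/-- The primed guard is met by the conjugated embedding: `ῑ₁ ∘ (c_L ∘ j) = ι₁ ∘ j`. [folklore] -/
theorem starRingEnd_comp_comp_conjRingHomK_comp (j : K →+* L) (ι₁ : L →+* ℂ) :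
    ((starRingEnd ℂ).comp ι₁).comp ((conjRingHomK L).comp j) = ι₁.comp j := by
  ext x
  rw [RingHom.comp_apply, RingHom.comp_apply, RingHom.comp_apply, RingHom.comp_apply, embedding_conjRingHomK,
    starRingEnd_self_apply]

/-- **(S1′) on the type**: (J4a) read at `ῑ₁` through the guard-meeting embedding `c_L ∘ j` is (J4a) for the CONJUGATE type:
`Φ^{(h)}_{c_L∘j, ῑ₁}(Ψ) = Φ^{(h)}_{c_L∘j, ι₁}(Ψ) = \overline{Φ^{(h)}_{j, ι₁}(Ψ)} = Φ^{(h)}_{j, ι₁}(Ψ̄)` — at a served slot (`Φ^δ(a_i) = Φ_{j,ι₁}(Ψ_i)`,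
MIRROR) the primed (J4a) names the MIRROR LINE `−a_i` (`Φ^δ(−a) = \overline{Φ^δ(a)}`). [folklore] -/
theorem liftType_conjRingHomK_comp (h : Bool) (j : K →+* L) (ι₁ : L →+* ℂ) (Ψ : CMType K) :
    liftType h K L ((conjRingHomK L).comp j) ι₁ Ψ = HodgeCM.CMTypeOps.bar (liftType h K L j ι₁ Ψ) :=
  Subtype.ext (Set.ext fun τ => by
    show kappa h K L ((conjRingHomK L).comp j) ι₁ τ ∈ Ψ.1 ↔ τ ∈ (HodgeCM.CMTypeOps.bar (liftType h K L j ι₁ Ψ)).1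
    rw [kappa_conjRingHomK_comp, HodgeCM.CMTypeOps.mem_bar_iff, mem_liftType_iff]
    exact HodgeCM.CMTypeOps.conjugate_mem_iff_notMem Ψ _)

/-! ## (S2) The sign recipe under the JOINT flip `(h, j, ι₁) ↦ (¬h, c_L ∘ j, ῑ₁)` — the flip the primed supply guard performs -/

/-- On the orbit of `ι₁` the two recipe bits give conjugate `κ`: `κ^{(¬h)}(τ) = \overline{κ^{(h)}(τ)}`. [folklore] -/
theorem kappa_not_eq_conjugate (h : Bool) (j : K →+* L) {ι₁ τ : L →+* ℂ} (g : L ≃+* L) (hg : ι₁.comp g.toRingHom = τ) :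
    kappa (!h) K L j ι₁ τ = conjugate (kappa h K L j ι₁ τ) := by
  cases h
  · exact kappa_true_eq_conjugate j g hg
  · show kappa false K L j ι₁ τ = conjugate (kappa true K L j ι₁ τ)
    rw [kappa_true_eq_conjugate j g hg]
    exact (involutive_conjugate K _).symm

/-- **(S2a) `κ` is INVARIANT under the joint flip** `(h, j, ι₁) ↦ (¬h, c_L ∘ j, ῑ₁)` (on the orbit of `ι₁`; always when `L/ℚ` is normal):
the two conjugations (bit, guard) cancel and the presentation embedding does not enter. [folklore] -/
theorem kappa_jointFlip (h : Bool) (j : K →+* L) {ι₁ τ : L →+* ℂ} (g : L ≃+* L) (hg : ι₁.comp g.toRingHom = τ) :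
    kappa (!h) K L ((conjRingHomK L).comp j) ((starRingEnd ℂ).comp ι₁) τ = kappa h K L j ι₁ τ := by
  rw [kappa_starRingEnd_comp, kappa_conjRingHomK_comp, kappa_not_eq_conjugate h j g hg]
  exact involutive_conjugate K _

/-- Hence the recipe TYPE is invariant under the joint flip (full orbit). [folklore] -/
theorem liftType_jointFlip (h : Bool) (j : K →+* L) (ι₁ : L →+* ℂ) (Ψ : CMType K)
    (horbit : ∀ τ : L →+* ℂ, ∃ g : L ≃+* L, ι₁.comp g.toRingHom = τ) :
    liftType (!h) K L ((conjRingHomK L).comp j) ((starRingEnd ℂ).comp ι₁) Ψ = liftType h K L j ι₁ Ψ :=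
  Subtype.ext (Set.ext fun τ => by
    obtain ⟨g, hg⟩ := horbit τ
    show kappa (!h) K L ((conjRingHomK L).comp j) ((starRingEnd ℂ).comp ι₁) τ ∈ Ψ.1 ↔ kappa h K L j ι₁ τ ∈ Ψ.1
    rw [kappa_jointFlip h j g hg])

/-- **(S2b) the frame sign FLIPS with the presentation embedding**: `τ` is the representative of its place for `ῑ₁` iff it is NOT for `ι₁`
(`Im ῑ₁(η_L) = −Im ι₁(η_L)`). [folklore] -/
theorem isRep_starRingEnd_comp_iff (ι₁ τ : L →+* ℂ) : IsRep L ((starRingEnd ℂ).comp ι₁) τ ↔ ¬IsRep L ι₁ τ := by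
  unfold IsRep
  rw [RingHom.comp_apply, Complex.conj_im, mul_neg]
  have hne : (τ (eta L)).im * (ι₁ (eta L)).im ≠ 0 :=
    mul_ne_zero (embedding_eta_im_ne_zero L τ) (embedding_eta_im_ne_zero L ι₁)
  constructor
  · intro h h'
    linarith
  · intro h
    rcases lt_or_gt_of_ne hne with hlt | hgt
    · linarith
    · exact absurd hgt h

/-- (Ported shape of `frameSign_conjugate`, in the OTHER variable.) [folklore] -/
theorem frameSign_starRingEnd_comp (ι₁ τ : L →+* ℂ) :
    frameSign L ((starRingEnd ℂ).comp ι₁) τ = !(frameSign L ι₁ τ) := by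
  classical
  by_cases h : IsRep L ι₁ τ
  · have h' : ¬IsRep L ((starRingEnd ℂ).comp ι₁) τ := fun h' => (isRep_starRingEnd_comp_iff ι₁ τ).mp h' h
    simp [frameSign, h, h']
  · have h' : IsRep L ((starRingEnd ℂ).comp ι₁) τ := (isRep_starRingEnd_comp_iff ι₁ τ).mpr h
    simp [frameSign, h, h']

/-- **(S2c) the REQUIRED SIGN FLIPS under the joint flip** (full orbit): `κ` invariant (S2a), frame sign flipped (S2b). [folklore] -/
theorem reqPos_jointFlip (h : Bool) (j : K →+* L) (ι₁ : L →+* ℂ) (Ψ : CMType K)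
    (horbit : ∀ τ : L →+* ℂ, ∃ g : L ≃+* L, ι₁.comp g.toRingHom = τ) (τ : L →+* ℂ) :
    reqPos (!h) K L ((conjRingHomK L).comp j) ((starRingEnd ℂ).comp ι₁) Ψ τ = !(reqPos h K L j ι₁ Ψ τ) := by
  obtain ⟨g, hg⟩ := horbit τ
  unfold reqPos
  rw [kappa_jointFlip h j g hg, frameSign_starRingEnd_comp]
  by_cases hc : ind Ψ (kappa h K L j ι₁ τ) = 1 <;> simp [hc]

/-- **(S2d) THE FORCED SIGNS UNDER THE JOINT FLIP ARE THE OPPOSITE ONES** (full orbit): the primed supply guard's `SignsForced` clause for a seesaw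
datum `D` says `0 < Re τ(a_i) ↔ reqPos^{(h)}_{j,ι₁}(Ψ_i, τ) = false` — i.e. it is the UNPRIMED clause for the MIRROR datum (lines `−a_i`). [folklore] -/
theorem signsForced_jointFlip_iff (h : Bool) (j : K →+* L) (ι₁ : L →+* ℂ) (Ψ : Fin 4 → CMType K) (D : StubTree.SeesawDatum L)
    (horbit : ∀ τ : L →+* ℂ, ∃ g : L ≃+* L, ι₁.comp g.toRingHom = τ) :
    SignsForced (!h) K L ((conjRingHomK L).comp j) ((starRingEnd ℂ).comp ι₁) Ψ D ↔
      ∀ (i : Fin 4) (τ : L →+* ℂ), (0 < (τ (D.a i)).re ↔ reqPos h K L j ι₁ (Ψ i) τ = false) := by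
  unfold SignsForced
  refine forall_congr' fun i => forall_congr' fun τ => ?_
  rw [reqPos_jointFlip h j ι₁ (Ψ i) horbit τ, Bool.not_eq_true']

/-- **Corollary: for ONE datum the unprimed and the primed supply guards are MUTUALLY EXCLUSIVE** (full orbit): the recipe forces
`sign Re τ(a_i)` one way, its joint flip the other way. [folklore] -/
theorem not_signsForced_jointFlip (h : Bool) (j : K →+* L) (ι₁ : L →+* ℂ) (Ψ : Fin 4 → CMType K) (D : StubTree.SeesawDatum L)
    (horbit : ∀ τ : L →+* ℂ, ∃ g : L ≃+* L, ι₁.comp g.toRingHom = τ) (hs : SignsForced h K L j ι₁ Ψ D) :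
    ¬ SignsForced (!h) K L ((conjRingHomK L).comp j) ((starRingEnd ℂ).comp ι₁) Ψ D := by
  intro hs'
  have h1 := hs 0 ι₁
  have h2 := (signsForced_jointFlip_iff h j ι₁ Ψ D horbit).mp hs' 0 ι₁
  -- `Re ι₁(a_0) ≠ 0` (totally real non-zero scalar), so the two clauses contradict each other
  have hne : (ι₁ (D.a 0)).re ≠ 0 := re_embedding_ne_zero_of_conj_eq (D.a_real 0) (D.a_ne 0) ι₁
  rcases lt_or_gt_of_ne hne with hlt | hgt
  · have : ¬ 0 < (ι₁ (D.a 0)).re := not_lt.mpr hlt.le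
    have e1 : reqPos h K L j ι₁ (Ψ 0) ι₁ = false := by simpa [this] using h1
    have e2 : ¬ reqPos h K L j ι₁ (Ψ 0) ι₁ = false := by simpa [this] using h2
    exact e2 e1
  · exact absurd ((h2.mp hgt)) (by simpa using (h1.mp hgt))

/-- **(S2e) AT ONE CONTEXT THE UNPRIMED AND THE PRIMED SUPPLY GUARDS EXCLUDE EACH OTHER** (full orbit of `ι₁`, e.g. `L/ℚ` normal): if `c` is a
good context for the bit `h` at `ι₁`, it is NOT one for the bit `¬h` at `ῑ₁` — the primed guard's embedding is forced to be `c_L ∘ j` and then (S2d)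
forces the opposite line signs on the SAME datum `c.D`.  With `h := orientBitι L ι₁` and `orientBitι_conjugate` this is
`GoodCtx (orientBitι L ι₁) ι₁ c → ¬ GoodCtx (orientBitι L ῑ₁) ῑ₁ c`: the primed junction is fed by MIRROR contexts (datum `−D`) or by nothing. [folklore] -/
theorem GoodCtx.not_jointFlip {h : Bool} {ι₁ : L →+* ℂ} {c : SeesawCtx L}
    (horbit : ∀ τ : L →+* ℂ, ∃ g : L ≃+* L, ι₁.comp g.toRingHom = τ) (hc : GoodCtx h ι₁ c) :
    ¬ GoodCtx (!h) ((starRingEnd ℂ).comp ι₁) c := by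
  intro hc'
  obtain ⟨j, hj, hs⟩ := hc.forced
  obtain ⟨j', hj', hs'⟩ := hc'.forced
  have hjj : j' = (conjRingHomK L).comp j := by
    refine RingHom.ext fun x => ι₁.injective ?_
    have e1 := RingHom.congr_fun hj' x
    have e2 := RingHom.congr_fun hj x
    rw [RingHom.comp_apply] at e1 e2
    symm
    rw [RingHom.comp_apply, embedding_conjRingHomK, e2, ← e1, RingHom.comp_apply, starRingEnd_self_apply]
  rw [hjj] at hs'
  exact not_signsForced_jointFlip h j ι₁ c.Ψ c.D horbit hs hs'

end SignRecipe

end HodgeCM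

end
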